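/-
Copyright (c) 2026. All rights reserved.
Released under Apache 2.0 license as described in the file LICENSE.
Authors: abc-iut cell, campaign-S prover seat abc-iut-S1 (gen 2).
-/
import Literature.LinearAlgebra.BaseChange.PiTensorRestrictScalars
import Literature.IUT.LogVolume.TensorPacketLemmas
import HarnessLib

/-!
# The comparison `⊗_ℚ k_i → ⊗_{ℚ_p} k_i` of tensor packets ([IUTchIII] Prop. 3.1, Rmk. 3.1.1 (i))

S. Mochizuki, *Inter-universal Teichmüller theory III*, kurims manuscript (May 2020), §3: the tensor
packet `log(^A𝓕_{v_ℚ}) := ⊗_{α∈A} log(^α𝓕_{v_ℚ})` of Prop. 3.1 (p. 92) is "to be understood as [a] tensor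
product of ind-topological modules", and Rmk. 3.1.1 (i) (p. 94) reads "each `log(^{A,α}𝓕_v)` is a
topological tensor product [say, over `ℚ`] of copies of `k̄`, hence may be described as an inductive limit
of direct sums of copies of `k̄`".  In the tree the packets are typed ALGEBRAICALLY over `ℚ`
(`⨂[ℚ]`: abc-iut-L6-t4 `Literature.IUT.LogThetaLattice.PacketN`/`MPacketN`, the Cor. 3.12 crew's
`Thm311.LogShells.Packet`), while the log-volume computations of [IUTchIV] §1 (Prop. 1.1–1.4) live on the
finite-dimensional `ℚ_p`-algebra `V = ⊗_{ℚ_p} k_i` (`PacketAlgebra p k`, `TensorPacketRing.lean`).  This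
THEOREMS-ONLY file is the COMPARISON between the two, for a finite family `k_i` of fields of the campaign-S
MLF class, phrased with the generic maps of `Literature/LinearAlgebra/BaseChange/PiTensorRestrictScalars.lean`:

* `θ := piTensorRestrictScalars ℚ ℚ_[p] k : (⨂[ℚ] i, k_i) →ₗ[ℚ] PacketAlgebra p k`, `⊗_ℚ x_i ↦ ⊗_{ℚ_p} x_i`
  (`ratPacket_tprod`), SURJECTIVE (`ratPacket_surjective`);
* `θ` carries the subgroup generated by the pure integral tensors ONTO `R_I`
  (`ratPacket_map_closure_integral_eq_integerPacket`, via abc-iut-S6's `mem_integerPacket_iff`) and the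
  subgroup generated by the pure tensors of `log_p(𝒪^×)`-elements ONTO `log_p(R_I^×)`
  (`ratPacket_map_closure_logUnits_eq_logPacket`) — and, generally, pure-tensor-generated subgroups onto
  pure-tensor-generated subgroups (`ratPacket_map_closure_tprodMem`);
* the DISTRIBUTED form at a fibre `{v | v_ℚ}`, `e := piTensorDistrib ℚ ℚ_[p] (fun _ v ↦ k_v) :
  ⨂[ℚ]_a (Π_v k_v) →ₗ[ℚ] Π_{v⃗} PacketAlgebra p (k ∘ v⃗)` (Prop. 3.1's displayed identification
  `⊗_α (⊕_v log(^α𝓕_v)) = ⊕_{v⃗} ⊗_α log(^α𝓕_{v_α})` followed by the comparison): `e (⊗ x_a) v⃗ = ⊗_{ℚ_p} x_a(v⃗ a)`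
  (`ratPacketDistrib_tprod`), SURJECTIVE (`ratPacketDistrib_surjective`), carrying the integral structure
  "formed by suitable direct sums and tensor products" ([IUTchIII] Prop. 3.2 (ii) p. 98) ONTO
  `Π_{v⃗} R_{v⃗}` resp. `Π_{v⃗} log_p(R_{v⃗}^×)` (`ratPacketDistrib_map_closure_integral`,
  `ratPacketDistrib_map_closure_logUnits`, general form `ratPacketDistrib_map_closure_tprodMem`);
* the ANALYTIC JUSTIFICATION of reading "topological tensor product [say, over `ℚ`]" as `⊗_{ℚ_p}`: a
  continuous additive map between topological `ℚ_p`-vector spaces is `ℚ_p`-linear (`ℚ` is dense in `ℚ_p`,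
  `Padic.denseRange_ratCast`; `map_padic_smul_of_continuous`), so every CONTINUOUS `ℚ`-multilinear map on
  `Π_i k_i` is (the restriction of) a `ℚ_p`-multilinear map (`exists_multilinearMap_padic_of_continuous`)
  and its linearisation factors through `θ` (`exists_lift_eq_comp_ratPacket`): `⊗_{ℚ_p} k_i`
  co-represents continuous `ℚ`-multilinear maps into Hausdorff topological `ℚ_p`-vector spaces.

The `ℚ`-module structure of each `k_i` is an instance argument (`[∀ i, Module ℚ (k i)]`; unique by
`subsingleton_rat_module`, compatible with `ℚ_p` by `IsScalarTower.rat`), so that the file applies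
verbatim to carriers presented as abstract `ℚ`-modules.  Classical linear algebra and `p`-adic density;
the [IUTchIII] locators record what the text prints; nothing here bears on the disputed Cor. 3.12.
No definitions (the two maps ARE the generic ones; consumers may abbreviate).
-/

noncomputable section

open PiTensorProduct Function Set
open Literature.LinearAlgebra.BaseChange
open scoped TensorProduct

namespace Literature.IUT.LogVolume

variable (p : ℕ) [Fact p.Prime]
variable {I : Type} [Fintype I] [DecidableEq I]
variable (k : I → Type) [∀ i, NontriviallyNormedField (k i)] [∀ i, NormedAlgebra ℚ_[p] (k i)]
  [∀ i, Module ℚ (k i)]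

/-! ## 1. The comparison map `θ` onto `V = ⊗_{ℚ_p} k_i` -/

omit [Fintype I] [DecidableEq I] in
/-- **The comparison map on pure tensors**: `θ (⊗_ℚ x_i) = ⊗_{ℚ_p} x_i` (`purePacket`) — the algebraic
`ℚ`-tensor model of the packet ([IUTchIII] Rmk. 3.1.1 (i) p. 94, "a topological tensor product [say,
over `ℚ`]") maps to the completed model `V` of [IUTchIV] Prop. 1.1. [claim: Mochizuki2012, status: disputed] -/
theorem ratPacket_tprod (x : ∀ i, k i) :
    piTensorRestrictScalars ℚ ℚ_[p] k (tprod ℚ x) = purePacket p k x :=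
  piTensorRestrictScalars_tprod ℚ ℚ_[p] k x

omit [Fintype I] [DecidableEq I] in
/-- **The comparison map is surjective** (`I ≠ ∅`): `V` is additively generated by pure tensors, and the
`ℚ_p`-scalars are absorbed into one slot. [claim: Mochizuki2012, status: disputed] -/
theorem ratPacket_surjective [Nonempty I] :
    Function.Surjective (piTensorRestrictScalars ℚ ℚ_[p] k) :=
  piTensorRestrictScalars_surjective ℚ ℚ_[p] k

omit [Fintype I] [DecidableEq I] in
/-- The comparison map carries the additive subgroup generated by the pure tensors with slots in
prescribed subsets `T_i ⊆ k_i` ONTO the subgroup of `V` generated by the pure tensors with slots in `T_i`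
(the shape of every "integral structure" of [IUTchIII] Prop. 3.1 (ii) / 3.2 (ii)).
[claim: Mochizuki2012, status: disputed] -/
theorem ratPacket_map_closure_tprodMem (T : ∀ i, Set (k i)) :
    (AddSubgroup.closure (tprodMem ℚ k T)).map (piTensorRestrictScalars ℚ ℚ_[p] k).toAddMonoidHom =
      AddSubgroup.closure {t | ∃ x : ∀ i, k i, (∀ i, x i ∈ T i) ∧ t = purePacket p k x} :=
  map_closure_tprodMem ℚ ℚ_[p] k T

omit [Fintype I] [DecidableEq I] in
/-- **The integral structure goes to `R_I`**: the subgroup of `⊗_ℚ k_i` generated by the pure tensors of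
integers `⊗ x_i`, `‖x_i‖ ≤ 1` (the image of `⊗_ℤ 𝒪_{k_i}`), is mapped ONTO `R_I = ⊗_{ℤ_p} R_i ⊆ V`
([IUTchIV] Prop. 1.1; abc-iut-S6's `mem_integerPacket_iff`: `R_I` is additively generated by the pure
integral tensors). [claim: Mochizuki2012, status: disputed] -/
theorem ratPacket_map_closure_integral_eq_integerPacket :
    (AddSubgroup.closure (tprodMem ℚ k fun i ↦ {x : k i | ‖x‖ ≤ 1})).map
        (piTensorRestrictScalars ℚ ℚ_[p] k).toAddMonoidHom =
      (integerPacket p k).toAddSubgroup := by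
  rw [ratPacket_map_closure_tprodMem]
  ext t
  rw [Subring.mem_toAddSubgroup, mem_integerPacket_iff]
  rfl

omit [Fintype I] [DecidableEq I] in
/-- **The log-shell structure goes to `log_p(R_I^×)`**: the subgroup of `⊗_ℚ k_i` generated by the pure
tensors `⊗ z_i` with `z_i ∈ log_p(𝒪_{k_i}^×)` is mapped ONTO `log_p(R_I^×) = ⊗_{ℤ_p} log_p(R_i^×) ⊆ V`
([IUTchIV] Prop. 1.2, `logPacket`). [claim: Mochizuki2012, status: disputed] -/
theorem ratPacket_map_closure_logUnits_eq_logPacket :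
    (AddSubgroup.closure (tprodMem ℚ k fun i ↦ logUnits (k i))).map
        (piTensorRestrictScalars ℚ ℚ_[p] k).toAddMonoidHom =
      logPacket p k :=
  ratPacket_map_closure_tprodMem p k _

/-! ## 2. The distributed form at a fibre `{v ∈ 𝕍 | v_ℚ}` -/

section Distribute

variable (α : Type) [Fintype α] {V : Type} [Fintype V] [DecidableEq V]
variable (kv : V → Type) [∀ v, NontriviallyNormedField (kv v)] [∀ v, NormedAlgebra ℚ_[p] (kv v)]
  [∀ v, Module ℚ (kv v)]

omit [Fintype α] [Fintype V] [DecidableEq V] in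
/-- **The distributed comparison map on pure tensors**: for
`e := piTensorDistrib ℚ ℚ_[p] (fun _ v ↦ k_v) : ⊗_{a,ℚ} (⊕_{v | v_ℚ} k_v) → Π_{v⃗ : α → V} ⊗_{a,ℚ_p} k_{v⃗(a)}`
one has `e (⊗_a x_a) v⃗ = ⊗_{ℚ_p} x_a(v⃗ a)` — the displayed identification of [IUTchIII] Prop. 3.1 (p. 92)
"`⊗_{α∈A} log(^α𝓕_{v_ℚ}) = ⊕_{{v_α}} ⊗_{α∈A} log(^α𝓕_{v_α})`, where … the direct sum is over all collections
`{v_α}_{α∈A}` of [not necessarily distinct!] elements `v_α ∈ 𝕍` lying over `v_ℚ`", followed summandwise by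
the comparison onto the completed packets `V_{v⃗}`. [claim: Mochizuki2012, status: disputed] -/
theorem ratPacketDistrib_tprod (x : α → ∀ v, kv v) (vA : α → V) :
    piTensorDistrib ℚ ℚ_[p] (fun (_ : α) v ↦ kv v) (tprod ℚ x) vA =
      purePacket p (fun a ↦ kv (vA a)) fun a ↦ x a (vA a) :=
  piTensorDistrib_tprod ℚ ℚ_[p] (fun (_ : α) v ↦ kv v) x vA

/-- **The distributed comparison map is surjective** (`A ≠ ∅`). [claim: Mochizuki2012, status: disputed] -/
theorem ratPacketDistrib_surjective [Nonempty α] :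
    Function.Surjective (piTensorDistrib ℚ ℚ_[p] fun (_ : α) v ↦ kv v) :=
  piTensorDistrib_surjective ℚ ℚ_[p] fun (_ : α) v ↦ kv v

/-- The integral structure "formed by suitable direct sums and tensor products" ([IUTchIII] Prop. 3.2 (ii)
p. 98) — the subgroup generated by the pure tensors all of whose components are integers — is mapped
ONTO `Π_{v⃗} R_{v⃗}`, the product of the integer packets of [IUTchIV] Prop. 1.1.
[claim: Mochizuki2012, status: disputed] -/
theorem ratPacketDistrib_map_closure_integral :
    (AddSubgroup.closure (tprodMem ℚ (fun _ : α ↦ ∀ v, kv v)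
        fun _ ↦ {x | ∀ v, x v ∈ {y : kv v | ‖y‖ ≤ 1}})).map
        (piTensorDistrib ℚ ℚ_[p] fun (_ : α) v ↦ kv v).toAddMonoidHom =
      AddSubgroup.pi Set.univ fun vA : α → V ↦ (integerPacket p fun a ↦ kv (vA a)).toAddSubgroup := by
  rw [piTensorDistrib_map_closure_tprodMem ℚ ℚ_[p] (fun (_ : α) v ↦ kv v)
    (fun _ v ↦ {y : kv v | ‖y‖ ≤ 1}) (fun _ v ↦ by simp)]
  congr 1
  funext vA
  ext t
  rw [Subring.mem_toAddSubgroup, mem_integerPacket_iff]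
  rfl

/-- The log-shell structure — the subgroup generated by the pure tensors all of whose components lie in
`log_p(𝒪_{k_v}^×)` — is mapped ONTO `Π_{v⃗} log_p(R_{v⃗}^×)`, the product of the `logPacket`s of [IUTchIV]
Prop. 1.2. [claim: Mochizuki2012, status: disputed] -/
theorem ratPacketDistrib_map_closure_logUnits [∀ v, IsUltrametricDist (kv v)] [∀ v, CompleteSpace (kv v)] :
    (AddSubgroup.closure (tprodMem ℚ (fun _ : α ↦ ∀ v, kv v)
        fun _ ↦ {x | ∀ v, x v ∈ logUnits (kv v)})).map
        (piTensorDistrib ℚ ℚ_[p] fun (_ : α) v ↦ kv v).toAddMonoidHom =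
      AddSubgroup.pi Set.univ fun vA : α → V ↦ logPacket p fun a ↦ kv (vA a) := by
  rw [piTensorDistrib_map_closure_tprodMem ℚ ℚ_[p] (fun (_ : α) v ↦ kv v)
    (fun _ v ↦ logUnits (kv v)) (fun _ v ↦ zero_mem_logUnits (p := p))]
  rfl

/-- General form: with `0 ∈ T_v ⊆ k_v`, the subgroup generated by the pure tensors with all components in
the `T_v` is mapped ONTO the product over `v⃗` of the subgroups of `V_{v⃗}` generated by the pure tensors
with slots in `T_{v⃗ a}` (e.g. `T_v = (p_v^*)⁻¹·log_p(𝒪_v^×)`, the mono-analytic log-shells of [IUTchIII]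
Def. 1.1 (i) / Prop. 1.2 (vi)). [claim: Mochizuki2012, status: disputed] -/
theorem ratPacketDistrib_map_closure_tprodMem (T : ∀ v, Set (kv v)) (hT : ∀ v, (0 : kv v) ∈ T v) :
    (AddSubgroup.closure (tprodMem ℚ (fun _ : α ↦ ∀ v, kv v) fun _ ↦ {x | ∀ v, x v ∈ T v})).map
        (piTensorDistrib ℚ ℚ_[p] fun (_ : α) v ↦ kv v).toAddMonoidHom =
      AddSubgroup.pi Set.univ fun vA : α → V ↦ AddSubgroup.closure
        {t | ∃ x : ∀ a, kv (vA a), (∀ a, x a ∈ T (vA a)) ∧ t = purePacket p (fun a ↦ kv (vA a)) x} :=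
  piTensorDistrib_map_closure_tprodMem ℚ ℚ_[p] (fun (_ : α) v ↦ kv v) (fun _ v ↦ T v) fun _ v ↦ hT v

end Distribute

/-! ## 3. Why `⊗_{ℚ_p}` is the topological tensor product over `ℚ` ([IUTchIII] Rmk. 3.1.1 (i)) -/

section Topological

variable {E F : Type*} [AddCommGroup E] [Module ℚ_[p] E] [TopologicalSpace E] [ContinuousSMul ℚ_[p] E]
  [AddCommGroup F] [Module ℚ_[p] F] [TopologicalSpace F] [ContinuousSMul ℚ_[p] F] [T2Space F]

omit [Fintype I] [DecidableEq I] in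
/-- **Automatic `ℚ_p`-linearity**: a continuous additive map between topological `ℚ_p`-vector spaces
(Hausdorff target) commutes with the `ℚ_p`-action — it commutes with the `ℚ`-action (`map_ratCast_smul`)
and `ℚ` is dense in `ℚ_p` (`Padic.denseRange_ratCast`). [cite: BourbakiAlgebraI1989, Ch. II §3 no. 3 Prop. 2] -/
theorem map_padic_smul_of_continuous {G : Type*} [FunLike G E F] [AddMonoidHomClass G E F] (f : G)
    (hf : Continuous f) (c : ℚ_[p]) (x : E) : f (c • x) = c • f x := by
  have h1 : Continuous fun c : ℚ_[p] ↦ f (c • x) := hf.comp (continuous_id.smul continuous_const)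
  have h2 : Continuous fun c : ℚ_[p] ↦ c • f x := continuous_id.smul continuous_const
  have heq := Continuous.ext_on (Padic.denseRange_ratCast (p := p)) h1 h2 (by
    rintro _ ⟨q, rfl⟩
    show f ((q : ℚ_[p]) • x) = (q : ℚ_[p]) • f x
    exact map_ratCast_smul f ℚ_[p] ℚ_[p] q x)
  exact congrFun heq c

variable [Module ℚ F]

omit [Fintype I] [DecidableEq I] in
/-- **A continuous `ℚ`-multilinear map on `Π_i k_i` is `ℚ_p`-multilinear** (with values in a Hausdorff
topological `ℚ_p`-vector space): there is a `ℚ_p`-multilinear map with the same underlying function (each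
slot map `x ↦ f(…, x, …)` is additive and continuous, hence `ℚ_p`-linear).  This is the content of reading
the packet as "a topological tensor product [say, over `ℚ`]" ([IUTchIII] Rmk. 3.1.1 (i) p. 94): over `ℚ` or
over `ℚ_p`, the continuous multilinear maps are the same. [claim: Mochizuki2012, status: disputed] -/
theorem exists_multilinearMap_padic_of_continuous (f : MultilinearMap ℚ k F) (hf : Continuous f) :
    ∃ g : MultilinearMap ℚ_[p] k F, (g : (∀ i, k i) → F) = f := by
  classical
  refine ⟨{ toFun := f
            map_update_add' := fun m i x y ↦ f.map_update_add m i x y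
            map_update_smul' := ?_ }, rfl⟩
  intro _ m i c x
  -- the slot map `y ↦ f (update m i y)` is additive and continuous
  let g : k i →+ F :=
    { toFun := fun y ↦ f (update m i y)
      map_zero' := f.map_coord_zero i (by simp)
      map_add' := fun y z ↦ f.map_update_add m i y z }
  have hg : Continuous g := hf.comp (continuous_const.update i continuous_id)
  exact map_padic_smul_of_continuous p g hg c x

omit [Fintype I] [DecidableEq I] in
/-- **Universal property**: the `ℚ`-linearisation `⊗_ℚ k_i → F` of a continuous `ℚ`-multilinear map
factors through the comparison map `θ : ⊗_ℚ k_i → ⊗_{ℚ_p} k_i` (through the `ℚ_p`-linearisation of the same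
map).  Together with `ratPacket_surjective`: `V = ⊗_{ℚ_p} k_i` is the quotient of `⊗_ℚ k_i` co-representing
continuous `ℚ`-multilinear maps into Hausdorff topological `ℚ_p`-vector spaces — the "topological tensor
product [say, over `ℚ`]" of [IUTchIII] Rmk. 3.1.1 (i). [claim: Mochizuki2012, status: disputed] -/
theorem exists_lift_eq_comp_ratPacket (f : MultilinearMap ℚ k F) (hf : Continuous f) :
    ∃ g : MultilinearMap ℚ_[p] k F, (g : (∀ i, k i) → F) = f ∧
      PiTensorProduct.lift f =
        ((PiTensorProduct.lift g).restrictScalars ℚ) ∘ₗ piTensorRestrictScalars ℚ ℚ_[p] k := by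
  obtain ⟨g, hg⟩ := exists_multilinearMap_padic_of_continuous p k f hf
  refine ⟨g, hg, ?_⟩
  ext m
  simp [← hg]

end Topological

end Literature.IUT.LogVolume

end
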